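import Mathlib
import HarnessLib
import Literature.Computability.AlgebraicComplexity.BDI20ColouringGadgets
import Literature.Computability.AlgebraicComplexity.BDI20GridLikeLayeredGraphs
import Literature.Computability.AlgebraicComplexity.BDI20EightRegularisationDegrees
import Literature.Computability.AlgebraicComplexity.BDI20EightRegularisation
import Literature.Computability.AlgebraicComplexity.BDI20CrossbarRelationalGrid
import Literature.Computability.AlgebraicComplexity.BDI20Sec8MapsFP

/-!
# BDI20 §8, Lemma 29: the `8`-regularised graph ON ℕ — closed-form mirrors of FILE D's
# positions and multiplicities over ℕ-level graph data, and the bridge theorems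

M. Bläser, J. Dörfler, C. Ikenmeyer, *On the complexity of evaluating highest weight vectors*,
arXiv:2002.11594 (= CCC 2021, LIPIcs 200:29), §8, Lemma 29 `lem:gridlikeethhardness` (TeX of record
`HOME/lit/src/2002.11594/fullversion.tex`, L2272–2283; = CCC 2021 Lemma 8.8) with Lemma 26 (L1917–1932;
= 8.5). Cell val-lit, typer t20 g10; the ℕ-level companion of FILE D (`BDI20EightRegularisationDegrees`
p549458, `BDI20EightRegularisation` p551222) requested by the closer-owner x6 g8 (bus 17:00Z (iii),
17:36Z «kit instance»; lead-np RULING (126)): the printed reduction is "polynomial-time" by inspection;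
the tree's Karp framework needs the map ON CODES, and x6's `BDI20Sec8MapsFP.lean` computes Lemma 25's
column lists from ANY `(n, pos, mult)` given on codes (`GridCols.posOf/multOf`). This file supplies the
regularised graph's `(n, pos, mult)` as CLOSED-FORM ℕ-FUNCTIONS of ℕ-level graph data and proves they
agree with FILE D — so that only their `CodeFP`-ness (list and arithmetic recursion, x6's kit) remains.
HONEST FRAMING: plumbing for an NP- and ETH-hardness transcription about EVALUATING highest weight
vectors; nothing here bears on `VP` versus `VNP`, which is NOT proved.

## Contents

* `RegN.*` — the ℕ-MIRRORS over `(N, pos : ℕ → ℕ × ℕ, eqB neB : ℕ → ℕ → Bool)`: `pairListN`,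
  `eqListN`, `neListN` (lexicographic `u < v`), `card₂N`, `loN/hiN/isHorN/parityN/placeN` (the parity
  mirroring placement of an edge), ℕ-indexed offset tables `offEqHN/offEqVN/offNeHN/offNeVN`, `memB`,
  `idxSum` (a `0/1` list sum over `List.range`), `incCountN`, `rankN` (equality gadgets first, each kind
  by list index = FILE D's `gOrd`), `shareN` (via FILE D's `shareTable`), `multOfN` and the four
  `8`-regular gadget tables `eqGadgetHMultN …`, `multEqN/multNeN`, and the two targets ★ `RegN.posN`,
  ★ `RegN.multN` (index decoding: `i < N` port `i`; `N ≤ i < N + 5·numEq` inner vertex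
  `(i−N) % 5 + 1` of equality gadget `(i−N) / 5`; then inequality gadgets with `6` inner vertices each —
  exactly FILE D's `wEquiv = finSumFinEquiv / finProdFinEquiv`; `(0,0)` resp. `0` out of range, matching
  `GridCols.posOf/multOf`).
* The BRIDGE (`RelGridGraph.*`): `IsMirror H pos eqB neB` (the three `∀`-agreements; for the crossbar
  `crossbar_isMirror` by `rfl`), `pairList_map`, `eqList_map`, `eqListN_getD`, `loN_eq … placeN_eq`,
  the closed-form index `idxW` with `wEquiv_idxW`, `val_eq_idxW`, then ★ `posN_idxW : posN (idxW w) =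
  posW w`, `incCountN_eq`, `rankN_eq`, `shareN_eq`, `eqGadgetHMultN_eq …`, `multEqN_eq`, ★ `multN_idxW :
  multN (idxW w) (idxW w') = mult w w'`, and the total-function forms ★ `posOf_regularise :
  GridCols.posOf (H.regularise hiso hs) i = RegN.posN N pos eqB neB i`, ★ `multOf_regularise`,
  `card₂_eq`, specialised to the crossbar as `posOf_regularise_crossbar`, `multOf_regularise_crossbar`,
  `card₂_crossbar`.

No conjecture, no named fact, no `instance`, no notation, `0` sorries.

## References
* [BlaserDorflerIkenmeyer2020] arXiv:2002.11594, Lemma 26 proof (TeX L1917–1932), Lemma 29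
  (L2272–2283) (= CCC 2021 Lemmas 8.5, 8.8).
-/

namespace Literature.Computability.AlgebraicComplexity

namespace BDI2020

open Gadgets

/-! ## The ℕ-mirrors (no graph structure, no proofs: plain list and arithmetic recursion) -/

namespace RegN

/-- All pairs `(u, v)` with `u < v < N`, in lexicographic order (mirror of `RelGridGraph.pairList`).
[cite: BlaserDorflerIkenmeyer2020, Lemma 26, proof (arXiv; = CCC 2021 Lemma 8.5)] -/
def pairListN (N : ℕ) : List (ℕ × ℕ) :=
  ((List.range N).flatMap fun u => (List.range N).map fun v => (u, v)).filter fun p => decide (p.1 < p.2)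

/-- The equality edges (mirror of `RelGridGraph.eqList`). [cite: BlaserDorflerIkenmeyer2020, Lemma 26, proof (arXiv; = CCC 2021 Lemma 8.5)] -/
def eqListN (N : ℕ) (eqB : ℕ → ℕ → Bool) : List (ℕ × ℕ) := (pairListN N).filter fun p => eqB p.1 p.2

/-- The inequality edges (mirror of `RelGridGraph.neList`). [cite: BlaserDorflerIkenmeyer2020, Lemma 26, proof (arXiv; = CCC 2021 Lemma 8.5)] -/
def neListN (N : ℕ) (neB : ℕ → ℕ → Bool) : List (ℕ × ℕ) := (pairListN N).filter fun p => neB p.1 p.2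

/-- The vertex count of `G₂` (mirror of `RelGridGraph.card₂`). [cite: BlaserDorflerIkenmeyer2020, Lemma 29, proof (arXiv; = CCC 2021 Lemma 8.8)] -/
def card₂N (N : ℕ) (eqB neB : ℕ → ℕ → Bool) : ℕ :=
  N + ((eqListN N eqB).length * 5 + (neListN N neB).length * 6)

/-- The lower end (smaller coordinate sum) of an edge (mirror of `RelGridGraph.lo`). [cite: BlaserDorflerIkenmeyer2020, Lemma 26, proof (arXiv; = CCC 2021 Lemma 8.5)] -/
def loN (pos : ℕ → ℕ × ℕ) (e : ℕ × ℕ) : ℕ :=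
  if (pos e.1).1 + (pos e.1).2 ≤ (pos e.2).1 + (pos e.2).2 then e.1 else e.2

/-- The upper end of an edge (mirror of `RelGridGraph.hi`). [cite: BlaserDorflerIkenmeyer2020, Lemma 26, proof (arXiv; = CCC 2021 Lemma 8.5)] -/
def hiN (pos : ℕ → ℕ × ℕ) (e : ℕ × ℕ) : ℕ :=
  if (pos e.1).1 + (pos e.1).2 ≤ (pos e.2).1 + (pos e.2).2 then e.2 else e.1

/-- Whether an edge is horizontal (mirror of `RelGridGraph.isHor`). [cite: BlaserDorflerIkenmeyer2020, Lemma 26, proof (arXiv; = CCC 2021 Lemma 8.5)] -/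
def isHorN (pos : ℕ → ℕ × ℕ) (e : ℕ × ℕ) : Bool := decide ((pos e.1).2 = (pos e.2).2)

/-- The parity of the lower end (mirror of `RelGridGraph.parity`). [cite: BlaserDorflerIkenmeyer2020, Lemma 26, proof (arXiv; = CCC 2021 Lemma 8.5)] -/
def parityN (pos : ℕ → ℕ × ℕ) (e : ℕ × ℕ) : ℕ := ((pos (loN pos e)).1 + (pos (loN pos e)).2) % 2

/-- The parity-mirrored placement of an offset (mirror of `RelGridGraph.place`). [cite: BlaserDorflerIkenmeyer2020, Lemma 26, proof (arXiv; = CCC 2021 Lemma 8.5)] -/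
def placeN (pos : ℕ → ℕ × ℕ) (e : ℕ × ℕ) (o : ℕ × ℕ) : ℕ × ℕ :=
  let B := RelGridGraph.scalePos (pos (loN pos e))
  if isHorN pos e then
    (if parityN pos e = 0 then (B.1 + o.1, B.2 + o.2) else (B.1 + o.1, B.2 - o.2))
  else
    (if parityN pos e = 0 then (B.1 - o.1, B.2 + o.2) else (B.1 + o.1, B.2 + o.2))

/-- ℕ-indexed offset table of `H^=_1`. [cite: BlaserDorflerIkenmeyer2020, Lemma 26, Fig. eqneqgadget (arXiv; = CCC 2021 Lemma 8.5)] -/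
def offEqHN (i : ℕ) : ℕ × ℕ := if h : i < 7 then RelGridGraph.offEqH ⟨i, h⟩ else (0, 0)

/-- ℕ-indexed offset table of `H^=_2`. [cite: BlaserDorflerIkenmeyer2020, Lemma 26, Fig. eqneqgadget (arXiv; = CCC 2021 Lemma 8.5)] -/
def offEqVN (i : ℕ) : ℕ × ℕ := if h : i < 7 then RelGridGraph.offEqV ⟨i, h⟩ else (0, 0)

/-- ℕ-indexed offset table of `H^≠_1`. [cite: BlaserDorflerIkenmeyer2020, Lemma 26, Fig. eqneqgadget (arXiv; = CCC 2021 Lemma 8.5)] -/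
def offNeHN (i : ℕ) : ℕ × ℕ := if h : i < 8 then RelGridGraph.offNeH ⟨i, h⟩ else (0, 0)

/-- ℕ-indexed offset table of `H^≠_2`. [cite: BlaserDorflerIkenmeyer2020, Lemma 26, Fig. eqneqgadget (arXiv; = CCC 2021 Lemma 8.5)] -/
def offNeVN (i : ℕ) : ℕ × ℕ := if h : i < 8 then RelGridGraph.offNeV ⟨i, h⟩ else (0, 0)

/-- Whether `v` is an end of the edge `e`. [cite: BlaserDorflerIkenmeyer2020, Lemma 26, proof (arXiv; = CCC 2021 Lemma 8.5)] -/
def memB (e : ℕ × ℕ) (v : ℕ) : Bool := (e.1 == v) || (e.2 == v)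

/-- `Σ_{i < n} [f i]` as a list sum (the counting primitive of the port allocation). [cite: BlaserDorflerIkenmeyer2020, Lemma 26, proof (arXiv, TeX L1929–1932; = CCC 2021 Lemma 8.5)] -/
def idxSum (n : ℕ) (f : ℕ → Bool) : ℕ := ((List.range n).map fun i => if f i = true then 1 else 0).sum

/-- The number of gadgets at `v` (mirror of `RelGridGraph.incCount`). [cite: BlaserDorflerIkenmeyer2020, Lemma 26, proof (arXiv; = CCC 2021 Lemma 8.5)] -/
def incCountN (N : ℕ) (eqB neB : ℕ → ℕ → Bool) (v : ℕ) : ℕ :=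
  idxSum (eqListN N eqB).length (fun j => memB ((eqListN N eqB).getD j (0, 0)) v) +
    idxSum (neListN N neB).length (fun j => memB ((neListN N neB).getD j (0, 0)) v)

/-- The rank of the gadget (`b = true`: equality gadget `j`; else inequality gadget `j`) among the
gadgets at `v`, equality gadgets first, each kind by list index (mirror of `RelGridGraph.rank`).
[cite: BlaserDorflerIkenmeyer2020, Lemma 26, proof (arXiv; = CCC 2021 Lemma 8.5)] -/
def rankN (N : ℕ) (eqB neB : ℕ → ℕ → Bool) (b : Bool) (j v : ℕ) : ℕ :=
  if b then idxSum (eqListN N eqB).length (fun j' => memB ((eqListN N eqB).getD j' (0, 0)) v && decide (j' < j))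
  else idxSum (eqListN N eqB).length (fun j' => memB ((eqListN N eqB).getD j' (0, 0)) v) +
    idxSum (neListN N neB).length (fun j' => memB ((neListN N neB).getD j' (0, 0)) v && decide (j' < j))

/-- The port parameter of a gadget at `v` (mirror of `RelGridGraph.share`). [cite: BlaserDorflerIkenmeyer2020, Lemma 26, proof (arXiv; = CCC 2021 Lemma 8.5)] -/
def shareN (N : ℕ) (eqB neB : ℕ → ℕ → Bool) (b : Bool) (j v : ℕ) : ℕ :=
  RelGridGraph.shareTable (incCountN N eqB neB v) (rankN N eqB neB b j v)

/-- Symmetric weighted edge list to multiplicity function on ℕ (mirror of `Gadgets.multOf`). [cite: BlaserDorflerIkenmeyer2020, Lemma 26, proof (arXiv; = CCC 2021 Lemma 8.5)] -/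
def multOfN (L : List (ℕ × ℕ × ℕ)) (u v : ℕ) : ℕ :=
  (L.map fun t => if (t.1 = u ∧ t.2.1 = v) ∨ (t.1 = v ∧ t.2.1 = u) then t.2.2 else 0).sum

/-- `8`-regular `H^=_1` on ℕ (mirror of `eqGadgetHMult`). [cite: BlaserDorflerIkenmeyer2020, Lemma 26, proof (arXiv, TeX L1927–1932; = CCC 2021 Lemma 8.5)] -/
def eqGadgetHMultN (a b : ℕ) : ℕ → ℕ → ℕ :=
  multOfN [(0, 2, a), (0, 1, a), (1, 2, 6 - a), (2, 3, 2), (1, 3, 2), (3, 5, 2), (3, 4, 2),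
    (4, 5, 6 - b), (5, 6, b), (4, 6, b)]

/-- `8`-regular `H^=_2` on ℕ (mirror of `eqGadgetVMult`). [cite: BlaserDorflerIkenmeyer2020, Lemma 26, proof (arXiv, TeX L1927–1932; = CCC 2021 Lemma 8.5)] -/
def eqGadgetVMultN (a b : ℕ) : ℕ → ℕ → ℕ :=
  multOfN [(0, 1, b), (0, 2, b), (1, 2, 6 - b), (1, 3, 2), (2, 3, 2), (3, 4, 2), (3, 5, 2),
    (4, 5, 6 - a), (4, 6, a), (5, 6, a)]

/-- `8`-regular `H^≠_1` on ℕ (mirror of `neGadgetHMult`). [cite: BlaserDorflerIkenmeyer2020, Lemma 26, proof (arXiv, TeX L1927–1932; = CCC 2021 Lemma 8.5)] -/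
def neGadgetHMultN (a b : ℕ) : ℕ → ℕ → ℕ :=
  multOfN [(0, 2, a), (0, 1, a), (1, 2, 6 - a), (2, 3, 2), (1, 3, 2), (3, 4, 4), (4, 6, 2),
    (4, 5, 2), (5, 6, 6 - b), (6, 7, b), (5, 7, b)]

/-- `8`-regular `H^≠_2` on ℕ (mirror of `neGadgetVMult`). [cite: BlaserDorflerIkenmeyer2020, Lemma 26, proof (arXiv, TeX L1927–1932; = CCC 2021 Lemma 8.5)] -/
def neGadgetVMultN (a b : ℕ) : ℕ → ℕ → ℕ :=
  multOfN [(0, 1, b), (0, 2, b), (1, 2, 6 - b), (1, 3, 2), (2, 3, 2), (3, 4, 4), (4, 5, 2),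
    (4, 6, 2), (5, 6, 6 - a), (6, 7, a), (5, 7, a)]

/-- Local multiplicities of equality gadget `j` with its port allocation (mirror of `RelGridGraph.multEq`).
[cite: BlaserDorflerIkenmeyer2020, Lemma 26, proof (arXiv, TeX L1927–1932; = CCC 2021 Lemma 8.5)] -/
def multEqN (N : ℕ) (pos : ℕ → ℕ × ℕ) (eqB neB : ℕ → ℕ → Bool) (j a b : ℕ) : ℕ :=
  let e := (eqListN N eqB).getD j (0, 0)
  if isHorN pos e then
    eqGadgetHMultN (shareN N eqB neB true j (loN pos e)) (shareN N eqB neB true j (hiN pos e)) a b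
  else
    eqGadgetVMultN (shareN N eqB neB true j (hiN pos e)) (shareN N eqB neB true j (loN pos e)) a b

/-- Local multiplicities of inequality gadget `j` (mirror of `RelGridGraph.multNe`).
[cite: BlaserDorflerIkenmeyer2020, Lemma 26, proof (arXiv, TeX L1927–1932; = CCC 2021 Lemma 8.5)] -/
def multNeN (N : ℕ) (pos : ℕ → ℕ × ℕ) (eqB neB : ℕ → ℕ → Bool) (j a b : ℕ) : ℕ :=
  let e := (neListN N neB).getD j (0, 0)
  if isHorN pos e then
    neGadgetHMultN (shareN N eqB neB false j (loN pos e)) (shareN N eqB neB false j (hiN pos e)) a b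
  else
    neGadgetVMultN (shareN N eqB neB false j (hiN pos e)) (shareN N eqB neB false j (loN pos e)) a b

/-- **The positions of `G₂` on ℕ** (mirror of `pos₂`): index `i < N` is the port `i` at `4·pos i + (2,2)`;
`N ≤ i < N + 5·numEq` is inner vertex `(i−N) % 5 + 1` of equality gadget `(i−N) / 5`; then the
inequality gadgets with `6` inner vertices each; `(0,0)` out of range.
[cite: BlaserDorflerIkenmeyer2020, Lemma 26/29, proof (arXiv, TeX L1925–1926, L2278–2283; = CCC 2021 Lemmas 8.5/8.8)] -/
def posN (N : ℕ) (pos : ℕ → ℕ × ℕ) (eqB neB : ℕ → ℕ → Bool) (i : ℕ) : ℕ × ℕ :=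
  let eqL := eqListN N eqB
  let neL := neListN N neB
  if i < card₂N N eqB neB then
    if i < N then RelGridGraph.scalePos (pos i)
    else if i - N < eqL.length * 5 then
      (let e := eqL.getD ((i - N) / 5) (0, 0)
       placeN pos e (if isHorN pos e then offEqHN ((i - N) % 5 + 1) else offEqVN ((i - N) % 5 + 1)))
    else
      (let k := i - N - eqL.length * 5
       let e := neL.getD (k / 6) (0, 0)
       placeN pos e (if isHorN pos e then offNeHN (k % 6 + 1) else offNeVN (k % 6 + 1)))
  else (0, 0)

/-- **The multiplicities of `G₂` on ℕ** (mirror of `mult₂`, same index decoding as `posN`; `0` out of range).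
[cite: BlaserDorflerIkenmeyer2020, Lemma 26/29, proof (arXiv, TeX L1927–1932, L2278–2283; = CCC 2021 Lemmas 8.5/8.8)] -/
def multN (N : ℕ) (pos : ℕ → ℕ × ℕ) (eqB neB : ℕ → ℕ → Bool) (i i' : ℕ) : ℕ :=
  let eqL := eqListN N eqB
  let neL := neListN N neB
  let C := card₂N N eqB neB
  if i < C ∧ i' < C then
    if i < N then
      (if i' < N then 0
       else if i' - N < eqL.length * 5 then
         (let j := (i' - N) / 5
          let a := (i' - N) % 5 + 1
          let e := eqL.getD j (0, 0)
          if i = loN pos e then multEqN N pos eqB neB j 0 a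
          else if i = hiN pos e then multEqN N pos eqB neB j 6 a else 0)
       else
         (let k := i' - N - eqL.length * 5
          let j := k / 6
          let a := k % 6 + 1
          let e := neL.getD j (0, 0)
          if i = loN pos e then multNeN N pos eqB neB j 0 a
          else if i = hiN pos e then multNeN N pos eqB neB j 7 a else 0))
    else if i - N < eqL.length * 5 then
      (let j := (i - N) / 5
       let a := (i - N) % 5 + 1
       let e := eqL.getD j (0, 0)
       if i' < N then
         (if i' = loN pos e then multEqN N pos eqB neB j a 0
          else if i' = hiN pos e then multEqN N pos eqB neB j a 6 else 0)
       else if i' - N < eqL.length * 5 then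
         (if (i' - N) / 5 = j then multEqN N pos eqB neB j a ((i' - N) % 5 + 1) else 0)
       else 0)
    else
      (let k := i - N - eqL.length * 5
       let j := k / 6
       let a := k % 6 + 1
       let e := neL.getD j (0, 0)
       if i' < N then
         (if i' = loN pos e then multNeN N pos eqB neB j a 0
          else if i' = hiN pos e then multNeN N pos eqB neB j a 7 else 0)
       else if i' - N < eqL.length * 5 then 0
       else (if (i' - N - eqL.length * 5) / 6 = j then multNeN N pos eqB neB j a ((i' - N - eqL.length * 5) % 6 + 1) else 0))
  else 0

end RegN

/-! ## The bridge: an `H : RelGridGraph N` presented by ℕ-level data -/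

namespace RelGridGraph

variable {N : ℕ} (H : RelGridGraph N)

/-- `H` is presented by the ℕ-level data `(pos, eqB, neB)` (for the crossbar: `Crossbar.posN V`,
`Crossbar.eqB V`, `Crossbar.neB V adj`, by `rfl`). [cite: BlaserDorflerIkenmeyer2020, Lemma 28/29 (arXiv; = CCC 2021 Lemmas 8.7/8.8)] -/
structure IsMirror (pos : ℕ → ℕ × ℕ) (eqB neB : ℕ → ℕ → Bool) : Prop where
  /-- positions agree -/
  hpos : ∀ v : Fin N, H.pos v = pos v.val
  /-- equality adjacency agrees -/
  heq : ∀ u v : Fin N, H.eqAdj u v = eqB u.val v.val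
  /-- inequality adjacency agrees -/
  hne : ∀ u v : Fin N, H.neAdj u v = neB u.val v.val

/-- The pair of values of a pair of vertices (an edge of `H` on ℕ). [cite: BlaserDorflerIkenmeyer2020, Lemma 26, proof (arXiv; = CCC 2021 Lemma 8.5)] -/
def valval (p : Fin N × Fin N) : ℕ × ℕ := (p.1.val, p.2.val)

/-- The values of `finRange`. [folklore] -/
private theorem map_val_finRange (k : ℕ) : (List.finRange k).map Fin.val = List.range k := by
  apply List.ext_getElem (by simp)
  intro i h1 h2
  simp

/-- `pairList` under values is `pairListN`. [cite: BlaserDorflerIkenmeyer2020, Lemma 26, proof (arXiv; = CCC 2021 Lemma 8.5)] -/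
theorem pairList_map : (pairList N).map valval = RegN.pairListN N := by
  have h1 : ((List.finRange N).flatMap fun u => (List.finRange N).map fun v => (u, v)).map valval =
      (List.range N).flatMap fun u => (List.range N).map fun v => (u, v) := by
    rw [← map_val_finRange, List.flatMap_map, List.map_flatMap]
    simp only [List.map_map, Function.comp_def, valval]
  unfold pairList RegN.pairListN
  rw [← h1, List.filter_map]
  rfl

/-- `eqList` under values is `eqListN`. [cite: BlaserDorflerIkenmeyer2020, Lemma 26, proof (arXiv; = CCC 2021 Lemma 8.5)] -/
theorem eqList_map {pos : ℕ → ℕ × ℕ} {eqB neB : ℕ → ℕ → Bool} (hM : H.IsMirror pos eqB neB) :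
    H.eqList.map valval = RegN.eqListN N eqB := by
  unfold eqList RegN.eqListN
  rw [← pairList_map, List.filter_map]
  congr 1
  apply List.filter_congr
  intro p _
  simp [valval, hM.heq]

/-- `neList` under values is `neListN`. [cite: BlaserDorflerIkenmeyer2020, Lemma 26, proof (arXiv; = CCC 2021 Lemma 8.5)] -/
theorem neList_map {pos : ℕ → ℕ × ℕ} {eqB neB : ℕ → ℕ → Bool} (hM : H.IsMirror pos eqB neB) :
    H.neList.map valval = RegN.neListN N neB := by
  unfold neList RegN.neListN
  rw [← pairList_map, List.filter_map]
  congr 1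
  apply List.filter_congr
  intro p _
  simp [valval, hM.hne]

/-- `numEq` is the length of `eqListN`. [cite: BlaserDorflerIkenmeyer2020, Lemma 26, proof (arXiv; = CCC 2021 Lemma 8.5)] -/
theorem numEq_eq {pos : ℕ → ℕ × ℕ} {eqB neB : ℕ → ℕ → Bool} (hM : H.IsMirror pos eqB neB) :
    H.numEq = (RegN.eqListN N eqB).length := by
  rw [← H.eqList_map hM, List.length_map]; rfl

/-- `numNe` is the length of `neListN`. [cite: BlaserDorflerIkenmeyer2020, Lemma 26, proof (arXiv; = CCC 2021 Lemma 8.5)] -/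
theorem numNe_eq {pos : ℕ → ℕ × ℕ} {eqB neB : ℕ → ℕ → Bool} (hM : H.IsMirror pos eqB neB) :
    H.numNe = (RegN.neListN N neB).length := by
  rw [← H.neList_map hM, List.length_map]; rfl

/-- `card₂` is `card₂N`. [cite: BlaserDorflerIkenmeyer2020, Lemma 29, proof (arXiv; = CCC 2021 Lemma 8.8)] -/
theorem card₂_eq {pos : ℕ → ℕ × ℕ} {eqB neB : ℕ → ℕ → Bool} (hM : H.IsMirror pos eqB neB) :
    H.card₂ = RegN.card₂N N eqB neB := by
  unfold card₂ RegN.card₂N; rw [H.numEq_eq hM, H.numNe_eq hM]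

/-- The `j`-th equality edge under values. [cite: BlaserDorflerIkenmeyer2020, Lemma 26, proof (arXiv; = CCC 2021 Lemma 8.5)] -/
theorem eqListN_getD {pos : ℕ → ℕ × ℕ} {eqB neB : ℕ → ℕ → Bool} (hM : H.IsMirror pos eqB neB)
    (j : Fin H.numEq) : (RegN.eqListN N eqB).getD j.val (0, 0) = valval (H.edgeOf (Sum.inl j)) := by
  rw [← H.eqList_map hM, List.getD_eq_getElem _ _ (by rw [List.length_map]; exact j.2), List.getElem_map]
  rfl

/-- The `j`-th inequality edge under values. [cite: BlaserDorflerIkenmeyer2020, Lemma 26, proof (arXiv; = CCC 2021 Lemma 8.5)] -/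
theorem neListN_getD {pos : ℕ → ℕ × ℕ} {eqB neB : ℕ → ℕ → Bool} (hM : H.IsMirror pos eqB neB)
    (j : Fin H.numNe) : (RegN.neListN N neB).getD j.val (0, 0) = valval (H.edgeOf (Sum.inr j)) := by
  rw [← H.neList_map hM, List.getD_eq_getElem _ _ (by rw [List.length_map]; exact j.2), List.getElem_map]
  rfl

/-- The ℕ-level edge of a gadget. [cite: BlaserDorflerIkenmeyer2020, Lemma 26, proof (arXiv; = CCC 2021 Lemma 8.5)] -/
abbrev edgeN (g : H.GIdx) : ℕ × ℕ := valval (H.edgeOf g)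

/-- `lo` on ℕ. [cite: BlaserDorflerIkenmeyer2020, Lemma 26, proof (arXiv; = CCC 2021 Lemma 8.5)] -/
theorem loN_eq {pos : ℕ → ℕ × ℕ} {eqB neB : ℕ → ℕ → Bool} (hM : H.IsMirror pos eqB neB) (g : H.GIdx) :
    RegN.loN pos (H.edgeN g) = (H.lo g).val := by
  unfold RegN.loN lo edgeN valval
  simp only [← hM.hpos]
  split_ifs <;> rfl

/-- `hi` on ℕ. [cite: BlaserDorflerIkenmeyer2020, Lemma 26, proof (arXiv; = CCC 2021 Lemma 8.5)] -/
theorem hiN_eq {pos : ℕ → ℕ × ℕ} {eqB neB : ℕ → ℕ → Bool} (hM : H.IsMirror pos eqB neB) (g : H.GIdx) :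
    RegN.hiN pos (H.edgeN g) = (H.hi g).val := by
  unfold RegN.hiN hi edgeN valval
  simp only [← hM.hpos]
  split_ifs <;> rfl

/-- `isHor` on ℕ. [cite: BlaserDorflerIkenmeyer2020, Lemma 26, proof (arXiv; = CCC 2021 Lemma 8.5)] -/
theorem isHorN_eq {pos : ℕ → ℕ × ℕ} {eqB neB : ℕ → ℕ → Bool} (hM : H.IsMirror pos eqB neB) (g : H.GIdx) :
    RegN.isHorN pos (H.edgeN g) = H.isHor g := by
  unfold RegN.isHorN isHor edgeN valval
  simp only [← hM.hpos]

/-- `parity` on ℕ. [cite: BlaserDorflerIkenmeyer2020, Lemma 26, proof (arXiv; = CCC 2021 Lemma 8.5)] -/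
theorem parityN_eq {pos : ℕ → ℕ × ℕ} {eqB neB : ℕ → ℕ → Bool} (hM : H.IsMirror pos eqB neB) (g : H.GIdx) :
    RegN.parityN pos (H.edgeN g) = H.parity g := by
  unfold RegN.parityN parity
  rw [H.loN_eq hM, ← hM.hpos]

/-- `place` on ℕ. [cite: BlaserDorflerIkenmeyer2020, Lemma 26, proof (arXiv; = CCC 2021 Lemma 8.5)] -/
theorem placeN_eq {pos : ℕ → ℕ × ℕ} {eqB neB : ℕ → ℕ → Bool} (hM : H.IsMirror pos eqB neB) (g : H.GIdx)
    (o : ℕ × ℕ) : RegN.placeN pos (H.edgeN g) o = H.place g o := by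
  unfold RegN.placeN place
  rw [H.isHorN_eq hM, H.parityN_eq hM, H.loN_eq hM, ← hM.hpos]

/-! ### The index of a structured vertex and `wEquiv` -/

/-- The closed-form index of a structured vertex (inverse of `wEquiv` on values).
[cite: BlaserDorflerIkenmeyer2020, Lemma 29, proof (arXiv; = CCC 2021 Lemma 8.8)] -/
def idxW : H.W → ℕ
  | Sum.inl v => v.val
  | Sum.inr (Sum.inl (j, a)) => N + (a.val + 5 * j.val)
  | Sum.inr (Sum.inr (j, a)) => N + (H.numEq * 5 + (a.val + 6 * j.val))

/-- `wEquiv` at its unfolded type (for rewriting). [folklore] -/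
private def wEquivU : Fin (N + (H.numEq * 5 + H.numNe * 6)) ≃ H.W :=
  finSumFinEquiv.symm.trans
    (Equiv.sumCongr (Equiv.refl _)
      (finSumFinEquiv.symm.trans (Equiv.sumCongr finProdFinEquiv.symm finProdFinEquiv.symm)))

/-- `wEquivU` on a port index. [folklore] -/
private theorem wEquivU_castAdd (v : Fin N) : H.wEquivU (Fin.castAdd _ v) = Sum.inl v := by
  simp [wEquivU]

/-- `wEquivU` on an equality-gadget index. [folklore] -/
private theorem wEquivU_eq (j : Fin H.numEq) (a : Fin 5) :
    H.wEquivU (Fin.natAdd N (Fin.castAdd _ (finProdFinEquiv (j, a)))) = Sum.inr (Sum.inl (j, a)) := by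
  simp [wEquivU]

/-- `wEquivU` on an inequality-gadget index. [folklore] -/
private theorem wEquivU_ne (j : Fin H.numNe) (a : Fin 6) :
    H.wEquivU (Fin.natAdd N (Fin.natAdd _ (finProdFinEquiv (j, a)))) = Sum.inr (Sum.inr (j, a)) := by
  simp [wEquivU]

/-- The index of a structured vertex is below `card₂`. [cite: BlaserDorflerIkenmeyer2020, Lemma 29, proof (arXiv; = CCC 2021 Lemma 8.8)] -/
theorem idxW_lt (w : H.W) : H.idxW w < H.card₂ := by
  rcases w with v | ⟨⟨j, a⟩⟩ | ⟨⟨j, a⟩⟩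
  · show v.val < H.card₂
    have := v.2; unfold card₂; omega
  · show N + (a.val + 5 * j.val) < H.card₂
    have := j.2; have := a.2; unfold card₂; nlinarith
  · show N + (H.numEq * 5 + (a.val + 6 * j.val)) < H.card₂
    have := j.2; have := a.2; unfold card₂; nlinarith

/-- `wEquiv` maps the closed-form index back to the vertex. [cite: BlaserDorflerIkenmeyer2020, Lemma 29, proof (arXiv; = CCC 2021 Lemma 8.8)] -/
theorem wEquiv_idxW (w : H.W) : H.wEquiv ⟨H.idxW w, H.idxW_lt w⟩ = w := by
  rcases w with v | ⟨⟨j, a⟩⟩ | ⟨⟨j, a⟩⟩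
  · exact H.wEquivU_castAdd v
  · exact H.wEquivU_eq j a
  · exact H.wEquivU_ne j a

/-- The value of an index is the closed-form index of its vertex. [cite: BlaserDorflerIkenmeyer2020, Lemma 29, proof (arXiv; = CCC 2021 Lemma 8.8)] -/
theorem val_eq_idxW (x : Fin H.card₂) : x.val = H.idxW (H.wEquiv x) := by
  have h := H.wEquiv_idxW (H.wEquiv x)
  have := H.wEquiv.injective h
  exact (congrArg Fin.val this).symm

/-! ### Bridge for the positions -/

/-- **`posN` computes `posW`** at the closed-form index. [cite: BlaserDorflerIkenmeyer2020, Lemma 26/29, proof (arXiv, TeX L1925–1926; = CCC 2021 Lemmas 8.5/8.8)] -/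
theorem posN_idxW {pos : ℕ → ℕ × ℕ} {eqB neB : ℕ → ℕ → Bool} (hM : H.IsMirror pos eqB neB) (w : H.W) :
    RegN.posN N pos eqB neB (H.idxW w) = H.posW w := by
  have hC := H.card₂_eq hM
  have hE := H.numEq_eq hM
  have hlt := H.idxW_lt w
  rcases w with v | ⟨⟨j, a⟩⟩ | ⟨⟨j, a⟩⟩
  · simp only [idxW] at hlt ⊢
    unfold RegN.posN
    simp only [← hC, hlt, ↓reduceIte, v.2, ← hM.hpos]
    rfl
  · simp only [idxW] at hlt ⊢
    have ha := a.2
    have hj := j.2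
    have h1 : ¬ (N + (a.val + 5 * j.val) < N) := by omega
    have h2 : N + (a.val + 5 * j.val) - N < (RegN.eqListN N eqB).length * 5 := by rw [← hE]; omega
    have h3 : (N + (a.val + 5 * j.val) - N) / 5 = j.val := by omega
    have h4 : (N + (a.val + 5 * j.val) - N) % 5 = a.val := by omega
    unfold RegN.posN
    simp only [← hC, hlt, ↓reduceIte, h1, h2, h3, h4]
    rw [H.eqListN_getD hM j]
    change RegN.placeN pos (H.edgeN (Sum.inl j)) _ = _
    rw [H.placeN_eq hM, H.isHorN_eq hM]
    show _ = H.place (Sum.inl j) ((if H.isHor (Sum.inl j) then offEqH else offEqV) ⟨a.val + 1, by omega⟩)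
    have h5 : a.val + 1 < 7 := by omega
    cases H.isHor (Sum.inl j) <;> simp [RegN.offEqHN, RegN.offEqVN, h5]
  · simp only [idxW] at hlt ⊢
    have ha := a.2
    have hj := j.2
    have hNn := H.numNe_eq hM
    have h1 : ¬ (N + (H.numEq * 5 + (a.val + 6 * j.val)) < N) := by omega
    have h2 : ¬ (N + (H.numEq * 5 + (a.val + 6 * j.val)) - N < (RegN.eqListN N eqB).length * 5) := by
      rw [← hE]; omega
    have h3 : (N + (H.numEq * 5 + (a.val + 6 * j.val)) - N - (RegN.eqListN N eqB).length * 5) / 6 = j.val := by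
      rw [← hE]; omega
    have h4 : (N + (H.numEq * 5 + (a.val + 6 * j.val)) - N - (RegN.eqListN N eqB).length * 5) % 6 = a.val := by
      rw [← hE]; omega
    unfold RegN.posN
    simp only [← hC, hlt, ↓reduceIte, h1, h2, h3, h4]
    rw [H.neListN_getD hM j]
    change RegN.placeN pos (H.edgeN (Sum.inr j)) _ = _
    rw [H.placeN_eq hM, H.isHorN_eq hM]
    show _ = H.place (Sum.inr j) ((if H.isHor (Sum.inr j) then offNeH else offNeV) ⟨a.val + 1, by omega⟩)
    have h5 : a.val + 1 < 8 := by omega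
    cases H.isHor (Sum.inr j) <;> simp [RegN.offNeHN, RegN.offNeVN, h5]

/-- **The positions of `regularise H` on ℕ:** `GridCols.posOf (H.regularise …) = RegN.posN …` as
total functions. [cite: BlaserDorflerIkenmeyer2020, Lemma 29, proof (arXiv, TeX L2278–2283; = CCC 2021 Lemma 8.8)] -/
theorem posOf_regularise {pos : ℕ → ℕ × ℕ} {eqB neB : ℕ → ℕ → Bool} (hM : H.IsMirror pos eqB neB)
    (hiso : H.NoIsolated) (hs : H.EdgesSimple) (i : ℕ) :
    GridCols.posOf (H.regularise hiso hs) i = RegN.posN N pos eqB neB i := by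
  unfold GridCols.posOf
  split_ifs with h
  · show H.posW (H.wEquiv ⟨i, h⟩) = _
    have hv := H.val_eq_idxW ⟨i, h⟩
    simp only at hv
    conv_rhs => rw [hv]
    rw [H.posN_idxW hM]
  · unfold RegN.posN
    rw [← H.card₂_eq hM, if_neg h]

/-! ### Bridge for the counts, the port allocation and the local multiplicities -/

/-- List sums over `range` are `Finset` sums. [folklore] -/
private theorem sum_map_range (g : ℕ → ℕ) (n : ℕ) :
    ((List.range n).map g).sum = ∑ i ∈ Finset.range n, g i := by
  induction n with
  | zero => simp
  | succ n ih => rw [List.range_succ, List.map_append, List.sum_append, ih, Finset.sum_range_succ]; simp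

/-- A `0/1` sum over `Fin n` is an `idxSum`. [folklore] -/
private theorem sum_ite_eq_idxSum {n : ℕ} (P : Fin n → Prop) [DecidablePred P] (f : ℕ → Bool)
    (h : ∀ j : Fin n, f j.val = decide (P j)) :
    (∑ j : Fin n, if P j then 1 else 0) = RegN.idxSum n f := by
  unfold RegN.idxSum
  rw [sum_map_range]
  rw [← Fin.sum_univ_eq_sum_range (fun i => if f i = true then 1 else 0) n]
  refine Finset.sum_congr rfl fun j _ => ?_
  simp only [h j, decide_eq_true_eq]

/-- Membership of a port in a gadget, on ℕ. [cite: BlaserDorflerIkenmeyer2020, Lemma 26, proof (arXiv; = CCC 2021 Lemma 8.5)] -/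
theorem memB_edgeN (g : H.GIdx) (v : Fin N) : RegN.memB (H.edgeN g) v.val = decide (H.MemG g v) := by
  unfold RegN.memB MemG edgeN valval
  rw [Bool.eq_iff_iff]
  simp only [Bool.or_eq_true, beq_iff_eq, decide_eq_true_eq, Fin.ext_iff]
  rcases H.edgeOf_eq_lo_hi g with h | h <;> rw [h] <;> simp only <;> omega

/-- The index of a gadget inside its kind. [cite: BlaserDorflerIkenmeyer2020, Lemma 26, proof (arXiv; = CCC 2021 Lemma 8.5)] -/
def gIndex : H.GIdx → ℕ
  | Sum.inl j => j.val
  | Sum.inr j => j.val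

/-- **`incCountN` computes `incCount`.** [cite: BlaserDorflerIkenmeyer2020, Lemma 26, proof (arXiv, TeX L1929–1932; = CCC 2021 Lemma 8.5)] -/
theorem incCountN_eq {pos : ℕ → ℕ × ℕ} {eqB neB : ℕ → ℕ → Bool} (hM : H.IsMirror pos eqB neB)
    (v : Fin N) : RegN.incCountN N eqB neB v.val = H.incCount v := by
  unfold incCount RegN.incCountN
  rw [Finset.card_filter, Fintype.sum_sum_type, ← H.numEq_eq hM, ← H.numNe_eq hM]
  congr 1
  · refine (sum_ite_eq_idxSum _ _ fun j => ?_).symm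
    rw [H.eqListN_getD hM j]; exact H.memB_edgeN _ v
  · refine (sum_ite_eq_idxSum _ _ fun j => ?_).symm
    rw [H.neListN_getD hM j]; exact H.memB_edgeN _ v

/-- **`rankN` computes `rank`.** [cite: BlaserDorflerIkenmeyer2020, Lemma 26, proof (arXiv, TeX L1929–1932; = CCC 2021 Lemma 8.5)] -/
theorem rankN_eq {pos : ℕ → ℕ × ℕ} {eqB neB : ℕ → ℕ → Bool} (hM : H.IsMirror pos eqB neB)
    (g : H.GIdx) (v : Fin N) : RegN.rankN N eqB neB (H.isEqGadget g) (H.gIndex g) v.val = H.rank g v := by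
  unfold rank RegN.rankN
  rw [Finset.card_filter, Fintype.sum_sum_type, ← H.numEq_eq hM, ← H.numNe_eq hM]
  rcases g with j | j
  · simp only [isEqGadget, gIndex, ↓reduceIte]
    have h0 : (∑ j' : Fin H.numNe, if H.MemG (Sum.inr j') v ∧ H.gOrd (Sum.inr j') < H.gOrd (Sum.inl j)
        then 1 else 0) = 0 := by
      refine Finset.sum_eq_zero fun j' _ => ?_
      have : ¬ H.gOrd (Sum.inr j') < H.gOrd (Sum.inl j) := by simp only [gOrd]; have := j.2; omega
      simp [this]
    rw [h0, add_zero]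
    refine (sum_ite_eq_idxSum _ _ fun j' => ?_).symm
    rw [H.eqListN_getD hM j', H.memB_edgeN]
    simp only [gOrd]
    by_cases hm : H.MemG (Sum.inl j') v <;> by_cases hlt : j'.val < j.val <;> simp [hm, hlt]
  · simp only [isEqGadget, gIndex, Bool.false_eq_true, ↓reduceIte]
    congr 1
    · refine (sum_ite_eq_idxSum _ _ fun j' => ?_).symm
      rw [H.eqListN_getD hM j', H.memB_edgeN]
      have : H.gOrd (Sum.inl j') < H.gOrd (Sum.inr j) := by simp only [gOrd]; have := j'.2; omega
      simp [this]
    · refine (sum_ite_eq_idxSum _ _ fun j' => ?_).symm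
      rw [H.neListN_getD hM j', H.memB_edgeN]
      simp only [gOrd]
      by_cases hm : H.MemG (Sum.inr j') v <;> by_cases hlt : j'.val < j.val <;> simp [hm, hlt]

/-- **`shareN` computes `share`.** [cite: BlaserDorflerIkenmeyer2020, Lemma 26, proof (arXiv, TeX L1929–1932; = CCC 2021 Lemma 8.5)] -/
theorem shareN_eq {pos : ℕ → ℕ × ℕ} {eqB neB : ℕ → ℕ → Bool} (hM : H.IsMirror pos eqB neB)
    (g : H.GIdx) (v : Fin N) : RegN.shareN N eqB neB (H.isEqGadget g) (H.gIndex g) v.val = H.share g v := by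
  unfold RegN.shareN share
  rw [H.incCountN_eq hM, H.rankN_eq hM]

/-- `multOf` on ℕ: a weighted edge list over `Fin k` read through values. [cite: BlaserDorflerIkenmeyer2020, Lemma 26, proof (arXiv; = CCC 2021 Lemma 8.5)] -/
private theorem multOfN_map {k : ℕ} (L : List (Fin k × Fin k × ℕ)) (u v : Fin k) :
    RegN.multOfN (L.map fun t => (t.1.val, t.2.1.val, t.2.2)) u.val v.val = Gadgets.multOf L u v := by
  unfold RegN.multOfN Gadgets.multOf
  rw [List.map_map]
  congr 1
  refine List.map_congr_left fun t _ => ?_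
  simp only [Function.comp_apply, Fin.val_inj]

/-- `H^=_1` table on ℕ. [cite: BlaserDorflerIkenmeyer2020, Lemma 26, proof (arXiv, TeX L1927–1932; = CCC 2021 Lemma 8.5)] -/
theorem eqGadgetHMultN_eq (a b : ℕ) (u v : Fin 7) :
    RegN.eqGadgetHMultN a b u.val v.val = eqGadgetHMult a b u v := by
  rw [eqGadgetHMult, ← multOfN_map]; rfl

/-- `H^=_2` table on ℕ. [cite: BlaserDorflerIkenmeyer2020, Lemma 26, proof (arXiv, TeX L1927–1932; = CCC 2021 Lemma 8.5)] -/
theorem eqGadgetVMultN_eq (a b : ℕ) (u v : Fin 7) :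
    RegN.eqGadgetVMultN a b u.val v.val = eqGadgetVMult a b u v := by
  rw [eqGadgetVMult, ← multOfN_map]; rfl

/-- `H^≠_1` table on ℕ. [cite: BlaserDorflerIkenmeyer2020, Lemma 26, proof (arXiv, TeX L1927–1932; = CCC 2021 Lemma 8.5)] -/
theorem neGadgetHMultN_eq (a b : ℕ) (u v : Fin 8) :
    RegN.neGadgetHMultN a b u.val v.val = neGadgetHMult a b u v := by
  rw [neGadgetHMult, ← multOfN_map]; rfl

/-- `H^≠_2` table on ℕ. [cite: BlaserDorflerIkenmeyer2020, Lemma 26, proof (arXiv, TeX L1927–1932; = CCC 2021 Lemma 8.5)] -/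
theorem neGadgetVMultN_eq (a b : ℕ) (u v : Fin 8) :
    RegN.neGadgetVMultN a b u.val v.val = neGadgetVMult a b u v := by
  rw [neGadgetVMult, ← multOfN_map]; rfl

/-- **`multEqN` computes `multEq`.** [cite: BlaserDorflerIkenmeyer2020, Lemma 26, proof (arXiv, TeX L1927–1932; = CCC 2021 Lemma 8.5)] -/
theorem multEqN_eq {pos : ℕ → ℕ × ℕ} {eqB neB : ℕ → ℕ → Bool} (hM : H.IsMirror pos eqB neB)
    (j : Fin H.numEq) (a b : Fin 7) :
    RegN.multEqN N pos eqB neB j.val a.val b.val = H.multEq j a b := by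
  unfold RegN.multEqN multEq
  simp only [H.eqListN_getD hM j]
  change (if RegN.isHorN pos (H.edgeN (Sum.inl j)) = true then _ else _) = _
  rw [H.isHorN_eq hM, H.loN_eq hM, H.hiN_eq hM]
  have h1 := H.shareN_eq hM (Sum.inl j) (H.lo (Sum.inl j))
  have h2 := H.shareN_eq hM (Sum.inl j) (H.hi (Sum.inl j))
  simp only [isEqGadget, gIndex] at h1 h2
  rw [h1, h2, eqGadgetHMultN_eq, eqGadgetVMultN_eq]
  split_ifs <;> rfl

/-- **`multNeN` computes `multNe`.** [cite: BlaserDorflerIkenmeyer2020, Lemma 26, proof (arXiv, TeX L1927–1932; = CCC 2021 Lemma 8.5)] -/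
theorem multNeN_eq {pos : ℕ → ℕ × ℕ} {eqB neB : ℕ → ℕ → Bool} (hM : H.IsMirror pos eqB neB)
    (j : Fin H.numNe) (a b : Fin 8) :
    RegN.multNeN N pos eqB neB j.val a.val b.val = H.multNe j a b := by
  unfold RegN.multNeN multNe
  simp only [H.neListN_getD hM j]
  change (if RegN.isHorN pos (H.edgeN (Sum.inr j)) = true then _ else _) = _
  rw [H.isHorN_eq hM, H.loN_eq hM, H.hiN_eq hM]
  have h1 := H.shareN_eq hM (Sum.inr j) (H.lo (Sum.inr j))
  have h2 := H.shareN_eq hM (Sum.inr j) (H.hi (Sum.inr j))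
  simp only [isEqGadget, gIndex] at h1 h2
  rw [h1, h2, neGadgetHMultN_eq, neGadgetVMultN_eq]
  split_ifs <;> rfl

/-! ### Bridge for the multiplicities -/

/-- `multEqN` at explicit local indices. [cite: BlaserDorflerIkenmeyer2020, Lemma 26, proof (arXiv; = CCC 2021 Lemma 8.5)] -/
private theorem multEqN_mk {pos : ℕ → ℕ × ℕ} {eqB neB : ℕ → ℕ → Bool} (hM : H.IsMirror pos eqB neB)
    (j : Fin H.numEq) {a b : ℕ} (ha : a < 7) (hb : b < 7) :
    RegN.multEqN N pos eqB neB j.val a b = H.multEq j ⟨a, ha⟩ ⟨b, hb⟩ :=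
  H.multEqN_eq hM j ⟨a, ha⟩ ⟨b, hb⟩

/-- `multNeN` at explicit local indices. [cite: BlaserDorflerIkenmeyer2020, Lemma 26, proof (arXiv; = CCC 2021 Lemma 8.5)] -/
private theorem multNeN_mk {pos : ℕ → ℕ × ℕ} {eqB neB : ℕ → ℕ → Bool} (hM : H.IsMirror pos eqB neB)
    (j : Fin H.numNe) {a b : ℕ} (ha : a < 8) (hb : b < 8) :
    RegN.multNeN N pos eqB neB j.val a b = H.multNe j ⟨a, ha⟩ ⟨b, hb⟩ :=
  H.multNeN_eq hM j ⟨a, ha⟩ ⟨b, hb⟩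

/-- Index arithmetic of an inner vertex of an equality gadget. [folklore] -/
private theorem idx_facts_eq (j : Fin H.numEq) (a : Fin 5) :
    ¬ (N + (a.val + 5 * j.val) < N) ∧ N + (a.val + 5 * j.val) - N < H.numEq * 5 ∧
      (N + (a.val + 5 * j.val) - N) / 5 = j.val ∧ (N + (a.val + 5 * j.val) - N) % 5 = a.val := by
  have := j.2; have := a.2; omega

/-- Index arithmetic of an inner vertex of an inequality gadget. [folklore] -/
private theorem idx_facts_ne (j : Fin H.numNe) (a : Fin 6) :
    ¬ (N + (H.numEq * 5 + (a.val + 6 * j.val)) < N) ∧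
      ¬ (N + (H.numEq * 5 + (a.val + 6 * j.val)) - N < H.numEq * 5) ∧
      (N + (H.numEq * 5 + (a.val + 6 * j.val)) - N - H.numEq * 5) / 6 = j.val ∧
      (N + (H.numEq * 5 + (a.val + 6 * j.val)) - N - H.numEq * 5) % 6 = a.val := by
  have := j.2; have := a.2; omega

/-- **`multN` computes `mult`** at the closed-form indices. [cite: BlaserDorflerIkenmeyer2020, Lemma 26/29, proof (arXiv, TeX L1927–1932; = CCC 2021 Lemmas 8.5/8.8)] -/
theorem multN_idxW {pos : ℕ → ℕ × ℕ} {eqB neB : ℕ → ℕ → Bool} (hM : H.IsMirror pos eqB neB) (w w' : H.W) :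
    RegN.multN N pos eqB neB (H.idxW w) (H.idxW w') = H.mult w w' := by
  have hC := H.card₂_eq hM
  have hE := H.numEq_eq hM
  have hlt := H.idxW_lt w
  have hlt' := H.idxW_lt w'
  unfold RegN.multN
  simp only [← hC, ← hE, hlt, hlt', and_self, ↓reduceIte]
  rcases w with u | ⟨⟨j, a⟩⟩ | ⟨⟨j, a⟩⟩ <;> rcases w' with v | ⟨⟨j', a'⟩⟩ | ⟨⟨j', a'⟩⟩ <;>
    simp only [idxW]
  · -- port / port
    simp only [u.2, v.2, ↓reduceIte]; rfl
  · -- port / eq inner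
    obtain ⟨h1, h2, h3, h4⟩ := H.idx_facts_eq j' a'
    simp only [u.2, ↓reduceIte, h1, h2, h3, h4]
    rw [H.eqListN_getD hM j']
    change (if u.val = RegN.loN pos (H.edgeN (Sum.inl j')) then _
      else if u.val = RegN.hiN pos (H.edgeN (Sum.inl j')) then _ else _) = _
    rw [H.loN_eq hM, H.hiN_eq hM, H.multEqN_mk hM j' (by omega) (by omega),
      H.multEqN_mk hM j' (by omega) (by omega)]
    show _ = optMult (H.multEq j') (H.idxEq j' (Sum.inl u)) (some ⟨a'.val + 1, by omega⟩)
    simp only [idxEq, Fin.ext_iff]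
    split_ifs <;> rfl
  · -- port / ne inner
    obtain ⟨h1, h2, h3, h4⟩ := H.idx_facts_ne j' a'
    simp only [u.2, ↓reduceIte, h1, h2, h3, h4]
    rw [H.neListN_getD hM j']
    change (if u.val = RegN.loN pos (H.edgeN (Sum.inr j')) then _
      else if u.val = RegN.hiN pos (H.edgeN (Sum.inr j')) then _ else _) = _
    rw [H.loN_eq hM, H.hiN_eq hM, H.multNeN_mk hM j' (by omega) (by omega),
      H.multNeN_mk hM j' (by omega) (by omega)]
    show _ = optMult (H.multNe j') (H.idxNe j' (Sum.inl u)) (some ⟨a'.val + 1, by omega⟩)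
    simp only [idxNe, Fin.ext_iff]
    split_ifs <;> rfl
  · -- eq inner / port
    obtain ⟨h1, h2, h3, h4⟩ := H.idx_facts_eq j a
    simp only [v.2, ↓reduceIte, h1, h2, h3, h4]
    rw [H.eqListN_getD hM j]
    change (if v.val = RegN.loN pos (H.edgeN (Sum.inl j)) then _
      else if v.val = RegN.hiN pos (H.edgeN (Sum.inl j)) then _ else _) = _
    rw [H.loN_eq hM, H.hiN_eq hM, H.multEqN_mk hM j (by omega) (by omega),
      H.multEqN_mk hM j (by omega) (by omega)]
    show _ = optMult (H.multEq j) (some ⟨a.val + 1, by omega⟩) (H.idxEq j (Sum.inl v))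
    simp only [idxEq, Fin.ext_iff]
    split_ifs <;> rfl
  · -- eq inner / eq inner
    obtain ⟨h1, h2, h3, h4⟩ := H.idx_facts_eq j a
    obtain ⟨h1', h2', h3', h4'⟩ := H.idx_facts_eq j' a'
    simp only [↓reduceIte, h1, h2, h3, h4, h1', h2', h3', h4']
    rw [H.multEqN_mk hM j (by omega) (by omega)]
    show _ = optMult (H.multEq j) (some ⟨a.val + 1, by omega⟩) (H.idxEq j (Sum.inr (Sum.inl (j', a'))))
    simp only [idxEq, Fin.ext_iff, eq_comm]
    split_ifs <;> rfl
  · -- eq inner / ne inner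
    obtain ⟨h1, h2, h3, h4⟩ := H.idx_facts_eq j a
    obtain ⟨h1', h2', h3', h4'⟩ := H.idx_facts_ne j' a'
    simp only [↓reduceIte, h1, h2, h1', h2']
    rfl
  · -- ne inner / port
    obtain ⟨h1, h2, h3, h4⟩ := H.idx_facts_ne j a
    simp only [v.2, ↓reduceIte, h1, h2, h3, h4]
    rw [H.neListN_getD hM j]
    change (if v.val = RegN.loN pos (H.edgeN (Sum.inr j)) then _
      else if v.val = RegN.hiN pos (H.edgeN (Sum.inr j)) then _ else _) = _
    rw [H.loN_eq hM, H.hiN_eq hM, H.multNeN_mk hM j (by omega) (by omega),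
      H.multNeN_mk hM j (by omega) (by omega)]
    show _ = optMult (H.multNe j) (some ⟨a.val + 1, by omega⟩) (H.idxNe j (Sum.inl v))
    simp only [idxNe, Fin.ext_iff]
    split_ifs <;> rfl
  · -- ne inner / eq inner
    obtain ⟨h1, h2, h3, h4⟩ := H.idx_facts_ne j a
    obtain ⟨h1', h2', h3', h4'⟩ := H.idx_facts_eq j' a'
    simp only [↓reduceIte, h1, h2, h1', h2']
    rfl
  · -- ne inner / ne inner
    obtain ⟨h1, h2, h3, h4⟩ := H.idx_facts_ne j a
    obtain ⟨h1', h2', h3', h4'⟩ := H.idx_facts_ne j' a'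
    simp only [↓reduceIte, h1, h2, h3, h4, h1', h2', h3', h4']
    rw [H.multNeN_mk hM j (by omega) (by omega)]
    show _ = optMult (H.multNe j) (some ⟨a.val + 1, by omega⟩) (H.idxNe j (Sum.inr (Sum.inr (j', a'))))
    simp only [idxNe, Fin.ext_iff, eq_comm]
    split_ifs <;> rfl

/-- **The multiplicities of `regularise H` on ℕ:** `GridCols.multOf (H.regularise …) = RegN.multN …`
as total functions. [cite: BlaserDorflerIkenmeyer2020, Lemma 29, proof (arXiv, TeX L2278–2283; = CCC 2021 Lemma 8.8)] -/
theorem multOf_regularise {pos : ℕ → ℕ × ℕ} {eqB neB : ℕ → ℕ → Bool} (hM : H.IsMirror pos eqB neB)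
    (hiso : H.NoIsolated) (hs : H.EdgesSimple) (i i' : ℕ) :
    GridCols.multOf (H.regularise hiso hs) i i' = RegN.multN N pos eqB neB i i' := by
  unfold GridCols.multOf
  split_ifs with h h'
  · show H.mult (H.wEquiv ⟨i, h⟩) (H.wEquiv ⟨i', h'⟩) = _
    have hv := H.val_eq_idxW ⟨i, h⟩
    have hv' := H.val_eq_idxW ⟨i', h'⟩
    simp only at hv hv'
    conv_rhs => rw [hv, hv']
    rw [H.multN_idxW hM]
  · unfold RegN.multN
    rw [← H.card₂_eq hM, if_neg (fun hh => h' hh.2)]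
  · unfold RegN.multN
    rw [← H.card₂_eq hM, if_neg (fun hh => h hh.1)]

/-! ### The crossbar instance (FILE C′): the hypotheses `IsMirror` hold by `rfl` -/

/-- The crossbar `(V, adj)` of FILE C′ is presented by `Crossbar.posN V`, `Crossbar.eqB V`,
`Crossbar.neB V adj`. [cite: BlaserDorflerIkenmeyer2020, Lemma 28 (arXiv; = CCC 2021 Lemma 8.7)] -/
theorem crossbar_isMirror (V : ℕ) (adj : ℕ → ℕ → Bool) :
    (Crossbar.crossbar V adj).IsMirror (Crossbar.posN V) (Crossbar.eqB V) (Crossbar.neB V adj) :=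
  ⟨fun _ => rfl, fun _ _ => rfl, fun _ _ => rfl⟩

/-- The vertex count of the regularised crossbar on ℕ. [cite: BlaserDorflerIkenmeyer2020, Lemma 29, proof (arXiv; = CCC 2021 Lemma 8.8)] -/
theorem card₂_crossbar (V : ℕ) (adj : ℕ → ℕ → Bool) :
    (Crossbar.crossbar V adj).card₂ =
      RegN.card₂N (Crossbar.nV V) (Crossbar.eqB V) (Crossbar.neB V adj) :=
  (Crossbar.crossbar V adj).card₂_eq (crossbar_isMirror V adj)

/-- ★ The positions of the regularised crossbar on ℕ. [cite: BlaserDorflerIkenmeyer2020, Lemma 29, proof (arXiv, TeX L2278–2283; = CCC 2021 Lemma 8.8)] -/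
theorem posOf_regularise_crossbar (V : ℕ) (adj : ℕ → ℕ → Bool)
    (hiso : (Crossbar.crossbar V adj).NoIsolated) (hs : (Crossbar.crossbar V adj).EdgesSimple) (i : ℕ) :
    GridCols.posOf ((Crossbar.crossbar V adj).regularise hiso hs) i =
      RegN.posN (Crossbar.nV V) (Crossbar.posN V) (Crossbar.eqB V) (Crossbar.neB V adj) i :=
  (Crossbar.crossbar V adj).posOf_regularise (crossbar_isMirror V adj) hiso hs i

/-- ★ The multiplicities of the regularised crossbar on ℕ. [cite: BlaserDorflerIkenmeyer2020, Lemma 29, proof (arXiv, TeX L2278–2283; = CCC 2021 Lemma 8.8)] -/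
theorem multOf_regularise_crossbar (V : ℕ) (adj : ℕ → ℕ → Bool)
    (hiso : (Crossbar.crossbar V adj).NoIsolated) (hs : (Crossbar.crossbar V adj).EdgesSimple) (i i' : ℕ) :
    GridCols.multOf ((Crossbar.crossbar V adj).regularise hiso hs) i i' =
      RegN.multN (Crossbar.nV V) (Crossbar.posN V) (Crossbar.eqB V) (Crossbar.neB V adj) i i' :=
  (Crossbar.crossbar V adj).multOf_regularise (crossbar_isMirror V adj) hiso hs i i'

end RelGridGraph

end BDI2020

end Literature.Computability.AlgebraicComplexity
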